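import Summits.Ventures.Crystal3D.Theorems.StickyWulffConstantTextureLiminfTexShadowColumnChain
import HarnessLib

/-!
# The column word lemma, VI: A COLUMN FROM PLATE 1 TO PLATE 2 REALISES THE RELATING WORD — input (I5) at configuration level
# (terrace census, cf-p1 RULINGS (ccxxxv)(iii), (ccxli); lane T `TexShadow`, registered stub `stub_terraceCensus`, crux `TextureLiminfV5`)

HONEST FRAMING. Venture `Summits/Ventures/Crystal3D` (cell `crystal3d-full`), route `route-Ventures-StickyWulffConstant`, helper `--supports` the
law-v5 crux `TextureLiminfV5` (stmt-Ventures-23912), lane T, mechanism (β); owner of input (I5) `stub_columnWord`: 19480-p2 g15.  Census-free geometry;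
standard axioms; clean import closure (…ColumnChain only).  Nothing about energies; F-C1 not moved.

THE POINT.  Assembling …ColumnWord (`column_theorem`), …ColumnLabel / …ColumnChain (`column_chain`): a COLUMN `x 0, …, x M` of balls of a
`1`-separated `X` — consecutive contacts, every contact dozen close-packed — that STARTS at a plate-1 ball with its whole slot shell
(`x 0 + A₁ w ∈ X` for all slots, `x 0 ∈ (A₁· + u₁)''Λ₀`) and ENDS at a plate-2 ball with its whole slot shell (`x M + A₂ w ∈ X`, `x M ∈ (A₂· + u₂)''Λ₀`),
the two lattices being related by the census's reduced admissible word `κ` (`A₂·Λ₀ = (wordFrame A₁ κ)·Λ₀`), carries a chain of affine twin steps whose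
located mirror balls lie ON THE COLUMN, whose last lamella IS plate 2's affine lattice, and which realises the letters of `κ` IN ORDER: for each `j` a
column ball `x (idx (p j))` is crossed through a twin plane with unit normal `± (wordFrame A₁ (κ.drop (j+1))) μ_j` — the census's `j`-th plane.
* `fullShell_of_symmetric_contacts` — a mirror ball's dozen is not centrally symmetric, so a ball anchored in a frame whose contacts contain a
  centrally symmetric slot shell is FULL in that frame (mod-3 law `two_mul_sqrt_smul_menu_mem_iff`);
* **`column_realises_word`** — the statement above.
WHAT THIS IS NOT: the registered Def `stub_columnWord` (its binders belong to the (β) assembly, …LevelLedgerDefs currency) — this is the theorem it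
will be derived from; F-C1 not moved.
-/

noncomputable section

open scoped BigOperators

namespace Summit.Ventures.Crystal3D.Theorems

namespace ColumnWord

open Finset Summit.Ventures.Crystal3D
open Summit.Ventures.Crystal3D.Cruxes.TextureLiminf.TexShadow (E3 fccRef add_mem_fccRef)
open Literature.MathematicalPhysics.StatisticalMechanics (fccStacking)
open scoped InnerProductSpace

variable {X : Finset (EuclideanSpace ℝ (Fin 3))}

/-- A ball with its whole slot shell in a frame `B` has exactly those twelve contacts. -/
theorem contacts_eq_shell (hX : ∀ p ∈ X, ∀ q ∈ X, p ≠ q → 1 ≤ dist p q) (B : EuclideanSpace ℝ (Fin 3) ≃ₗᵢ[ℝ] EuclideanSpace ℝ (Fin 3))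
    {y : EuclideanSpace ℝ (Fin 3)} (hfull : ∀ w ∈ fccSlots, y + B w ∈ X) {z : EuclideanSpace ℝ (Fin 3)} (hz : z ∈ X) (hd : dist y z = 1) :
    ∃ w ∈ fccSlots, z = y + B w := by
  classical
  set S := fccSlots.image fun w => y + B w with hS
  have hsub : S ⊆ X.filter fun q => dist y q = 1 := by
    intro q hq
    obtain ⟨w, hw, rfl⟩ := Finset.mem_image.1 hq
    exact Finset.mem_filter.2 ⟨hfull w hw, by rw [dist_self_add_right, LinearIsometryEquiv.norm_map, norm_eq_one_of_mem_fccSlots hw]⟩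
  have hcardS : S.card = 12 := by
    rw [hS, Finset.card_image_of_injective _ (fun a b h => B.injective (add_left_cancel h)), card_fccSlots]
  have hle := card_filter_dist_eq_one_le_twelve X hX y
  have heq : S = X.filter fun q => dist y q = 1 := Finset.eq_of_subset_of_card_le hsub (by rw [hcardS]; exact hle)
  have hzS : z ∈ S := by rw [heq]; exact Finset.mem_filter.2 ⟨hz, hd⟩
  obtain ⟨w, hw, he⟩ := Finset.mem_image.1 hzS
  exact ⟨w, hw, he.symm⟩

/-- **A ball anchored in `A` whose contacts contain a CENTRALLY SYMMETRIC slot shell is `A`-FULL.**  (A mirror ball's dozen is not centrally symmetric: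
the antipode of a mirror site would be the mirror image of a far slot, which is no slot — the mod-3 law.) -/
theorem fullShell_of_symmetric_contacts (hX : ∀ p ∈ X, ∀ q ∈ X, p ≠ q → 1 ≤ dist p q) {y : EuclideanSpace ℝ (Fin 3)}
    (hcp : IsClosePackedDozenAt y (X.filter fun q => dist y q = 1))
    (A : EuclideanSpace ℝ (Fin 3) ≃ₗᵢ[ℝ] EuclideanSpace ℝ (Fin 3)) {a b c : EuclideanSpace ℝ (Fin 3)}
    (ha : a ∈ fccSlots) (hb : b ∈ fccSlots) (hc' : c ∈ fccSlots) (hind : LinearIndependent ℝ ![a, b, c])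
    (haX : y + A a ∈ X) (hbX : y + A b ∈ X) (hcX : y + A c ∈ X)
    (B : EuclideanSpace ℝ (Fin 3) ≃ₗᵢ[ℝ] EuclideanSpace ℝ (Fin 3)) (hBfull : ∀ w ∈ fccSlots, y + B w ∈ X) :
    ∀ w ∈ fccSlots, y + A w ∈ X := by
  rcases fullShell_or_twinDozen_of_isClosePackedDozenAt hcp A ha hb hc' hind haX hbX hcX with
    ⟨hfull, -⟩ | ⟨n, hn, hmenu, -, hmirror, -, hclass, -, -, -⟩
  · exact hfull
  · exfalso
    -- a near-polar slot `w₀` exists (the hemisphere lemma for `n`)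
    have hn0 : n ≠ 0 := by rw [← norm_ne_zero_iff, hn]; norm_num
    obtain ⟨w₀, hw₀, -, -, -, -, hw₀neg, -, -, -⟩ := exists_independent_slots_of_hemisphere A hn0
    -- its mirror site `v` is a contact, hence `y + B w` for a slot `w`; so is its antipode `y − B w = y + B (−w)`
    have hvX := hmirror w₀ hw₀ hw₀neg
    have hdv : dist y (y + (A w₀ - (2 * ⟪A w₀, n⟫_ℝ) • n)) = 1 := by
      rw [dist_self_add_right, ← twinFrame_apply A hn, LinearIsometryEquiv.norm_map, norm_eq_one_of_mem_fccSlots hw₀]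
    obtain ⟨w, hw, he⟩ := contacts_eq_shell hX B hBfull hvX hdv
    have hanti : y + B (-w) ∈ X := hBfull _ (neg_mem_fccSlots hw)
    have hdanti : dist y (y + B (-w)) = 1 := by
      rw [dist_self_add_right, LinearIsometryEquiv.norm_map, norm_neg, norm_eq_one_of_mem_fccSlots hw]
    have hBw : B w = A w₀ - (2 * ⟪A w₀, n⟫_ℝ) • n := (add_left_cancel he).symm
    -- the antipode `y − v` has `⟪−v, n⟫ = ⟪A w₀, n⟫ < 0`, so by the classification it is an OWN slot `A w'`
    have hw₀v : ⟪A w₀, n⟫_ℝ = -Real.sqrt (2 / 3) := by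
      rcases hmenu w₀ hw₀ with h | h | h
      · linarith
      · have := Real.sqrt_nonneg (2 / 3); linarith
      · exact h
    have hvn : ⟪A w₀ - (2 * ⟪A w₀, n⟫_ℝ) • n, n⟫_ℝ = Real.sqrt (2 / 3) := by
      rw [inner_sub_left, real_inner_smul_left, real_inner_self_eq_norm_sq, hn, hw₀v]; ring
    rcases hclass _ hanti hdanti with ⟨w', hw', hle, he'⟩ | ⟨w', hw', hlt, he'⟩
    · -- `A w' = −B w = −v`: then `A (w' + w₀) = 2⟪A w₀, n⟫ n = −2√(2/3) n ∈ A·Λ₀`, contradicting the mod-3 law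
      have hAw' : A w' = -(A w₀ - (2 * ⟪A w₀, n⟫_ℝ) • n) := by
        have := add_left_cancel he'; rw [map_neg, hBw] at this; exact this.symm
      have hsum : A (w' + w₀) = ((2 * ((-1 : ℤ) : ℝ)) * Real.sqrt (2 / 3)) • n := by
        rw [map_add, hAw', hw₀v]; push_cast
        rw [show (2 * -Real.sqrt (2 / 3)) • n = -((2 * Real.sqrt (2 / 3)) • n) by rw [← neg_smul]; ring_nf]
        rw [show (2 * (-1 : ℝ) * Real.sqrt (2 / 3)) • n = -((2 * Real.sqrt (2 / 3)) • n) by rw [← neg_smul]; ring_nf]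
        abel
      have hmem : ((2 * ((-1 : ℤ) : ℝ)) * Real.sqrt (2 / 3)) • n ∈ A '' fccRef :=
        ⟨w' + w₀, add_mem_fccRef (mem_fcc_of_mem_fccSlots hw') (mem_fcc_of_mem_fccSlots hw₀), hsum⟩
      have h3 := (two_mul_sqrt_smul_menu_mem_iff hn hmenu (-1)).1 hmem
      omega
    · -- a mirror site has positive `n`-component, but `−v` has negative: contradiction
      have h1 : ⟪A w' - (2 * ⟪A w', n⟫_ℝ) • n, n⟫_ℝ = -⟪A w', n⟫_ℝ := by
        rw [inner_sub_left, real_inner_smul_left, real_inner_self_eq_norm_sq, hn]; ring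
      have h2 : A w' - (2 * ⟪A w', n⟫_ℝ) • n = -(A w₀ - (2 * ⟪A w₀, n⟫_ℝ) • n) := by
        have := add_left_cancel he'; rw [map_neg, hBw] at this; exact this.symm
      have h3 := congrArg (fun v => ⟪v, n⟫_ℝ) h2
      simp only [inner_neg_left] at h3
      rw [h1, hvn] at h3
      have := Real.sqrt_nonneg (2 / 3)
      linarith

/-- **A COLUMN FROM PLATE 1 TO PLATE 2 REALISES THE RELATING WORD, LETTER BY LETTER, AT BALLS OF THE COLUMN** (input (I5) at configuration level).
Column `x 0, …, x M` in the `1`-separated `X`: consecutive contacts, close-packed contact dozens; `x 0` is a plate-1 ball with its slot shell in the frame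
`A₁` (affine lattice `(A₁· + u₁)''Λ₀`); `x M` is a plate-2 ball with its slot shell in `A₂` (`(A₂· + u₂)''Λ₀`); `κ` a reduced admissible model word with
`A₂·Λ₀ = (wordFrame A₁ κ)·Λ₀`.  Then there is a chain of `m` affine twin steps `(A, t, b, n)` starting at `(A₁, u₁)` whose mirror balls are column balls
`b ℓ = x (idx ℓ)`, with: (i) the last lamella is plate 2's affine lattice `(A₂· + u₂)''Λ₀`; (ii) positions `p 0 > … > p (|κ|−1)` such that at step
`p j` the frame is `wordFrame A₁ (κ.drop (j+1))` and the crossed unit normal is `± A (p j) μ_j`, `κ.drop j = μ_j :: κ.drop (j+1)`; (iii) integer layer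
indices with `t m = u₁ + Σ 2 j_ℓ √(2/3) n ℓ` and `u₂ − t m ∈ A₂·Λ₀`. -/
theorem column_realises_word (hX : ∀ p ∈ X, ∀ q ∈ X, p ≠ q → 1 ≤ dist p q)
    (x : ℕ → EuclideanSpace ℝ (Fin 3)) (M : ℕ)
    (hcol : ∀ k ≤ M, x k ∈ X ∧ IsClosePackedDozenAt (x k) (X.filter fun q => dist (x k) q = 1))
    (hd : ∀ k < M, dist (x k) (x (k + 1)) = 1)
    (A₁ A₂ : EuclideanSpace ℝ (Fin 3) ≃ₗᵢ[ℝ] EuclideanSpace ℝ (Fin 3)) (u₁ u₂ : EuclideanSpace ℝ (Fin 3))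
    (h₁L : x 0 ∈ (fun r => A₁ r + u₁) '' fccRef) (h₁full : ∀ w ∈ fccSlots, x 0 + A₁ w ∈ X)
    (h₂L : x M ∈ (fun r => A₂ r + u₂) '' fccRef) (h₂full : ∀ w ∈ fccSlots, x M + A₂ w ∈ X)
    {κ : List (EuclideanSpace ℝ (Fin 3))}
    (hκ : ∀ μ ∈ κ, ‖μ‖ = 1 ∧ ∀ w ∈ fccSlots, ⟪w, μ⟫_ℝ = 0 ∨ ⟪w, μ⟫_ℝ = Real.sqrt (2 / 3) ∨ ⟪w, μ⟫_ℝ = -Real.sqrt (2 / 3))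
    (hκc : List.IsChain (fun μ μ' => ⟪μ, μ'⟫_ℝ = 1 / 3 ∨ ⟪μ, μ'⟫_ℝ = -1 / 3) κ)
    (hrel : A₂ '' fccRef = (wordFrame A₁ κ) '' fccRef) :
    ∃ (m : ℕ) (A : ℕ → (EuclideanSpace ℝ (Fin 3) ≃ₗᵢ[ℝ] EuclideanSpace ℝ (Fin 3))) (t b n : ℕ → EuclideanSpace ℝ (Fin 3)) (idx : ℕ → ℕ),
      A 0 = A₁ ∧ t 0 = u₁ ∧
      (∀ ℓ < m, A (ℓ + 1) = twinFrame (A ℓ) (n ℓ) ∧ t (ℓ + 1) = t ℓ + (2 * ⟪b ℓ - t ℓ, n ℓ⟫_ℝ) • n ℓ ∧ ‖n ℓ‖ = 1 ∧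
        b ℓ ∈ (fun r => A ℓ r + t ℓ) '' fccRef ∧ idx ℓ ≤ M ∧ b ℓ = x (idx ℓ)) ∧
      (fun r => A m r + t m) '' fccRef = (fun r => A₂ r + u₂) '' fccRef ∧
      (∃ p : ℕ → ℕ,
        (∀ j < κ.length, p j < m ∧ A (p j) = wordFrame A₁ (κ.drop (j + 1)) ∧
          ∃ μ : EuclideanSpace ℝ (Fin 3), κ.drop j = μ :: κ.drop (j + 1) ∧ (n (p j) = A (p j) μ ∨ n (p j) = -A (p j) μ)) ∧
        ∀ j j', j < j' → j' < κ.length → p j' < p j) ∧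
      (∃ j : ℕ → ℤ, (∀ ℓ < m, ⟪b ℓ - t ℓ, n ℓ⟫_ℝ = j ℓ * Real.sqrt (2 / 3)) ∧
        t m = u₁ + ∑ ℓ ∈ Finset.range m, ((2 * j ℓ : ℝ) * Real.sqrt (2 / 3)) • n ℓ) ∧
      u₂ - t m ∈ A₂ '' fccRef := by
  -- anchoring at the start: any three independent slots of the full shell
  have hA₁0 : A₁ (EuclideanSpace.single (2 : Fin 3) (1 : ℝ)) ≠ 0 := by
    rw [← norm_ne_zero_iff, LinearIsometryEquiv.norm_map, PiLp.norm_single, norm_one]; norm_num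
  obtain ⟨a, ha, b, hb, c, hc, -, -, -, hind⟩ := exists_independent_slots_of_hemisphere A₁ hA₁0
  obtain ⟨m, A, t, bb, n, idx, hA0, ht0, hstep, horig, hmenu, hbL, hidx, hML, hManch⟩ :=
    column_chain A₁ u₁ x M hcol hd h₁L ⟨a, ha, b, hb, c, hc, hind, h₁full a ha, h₁full b hb, h₁full c hc⟩
  obtain ⟨hMX, hMcp⟩ := hcol M le_rfl
  -- the last ball is `A m`-FULL (plate 2's shell is centrally symmetric), hence plate matching applies
  obtain ⟨a', ha', b', hb', c', hc', hind', haX, hbX, hcX⟩ := hManch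
  have hfullM : ∀ w ∈ fccSlots, x M + A m w ∈ X := fullShell_of_symmetric_contacts hX hMcp (A m) ha' hb' hc' hind' haX hbX hcX A₂ h₂full
  have hdoz : ∀ w ∈ fccSlots, x M + A m w ∈ (fun r => A₂ r + u₂) '' fccRef := by
    intro w hw
    have hd1 : dist (x M) (x M + A m w) = 1 := by
      rw [dist_self_add_right, LinearIsometryEquiv.norm_map, norm_eq_one_of_mem_fccSlots hw]
    obtain ⟨w', hw', he⟩ := contacts_eq_shell hX A₂ h₂full (hfullM w hw) hd1
    rw [he, mem_affLat_iff_sub_mem h₂L, add_sub_cancel_left]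
    exact ⟨w', mem_fcc_of_mem_fccSlots hw', rfl⟩
  -- the column theorem
  obtain ⟨haff, hp, hj, hst⟩ := column_theorem (m := m) hstep horig hmenu hbL hML h₂L hdoz hκ hκc (by rw [hA0]; exact hrel)
  refine ⟨m, A, t, bb, n, idx, hA0, ht0, fun ℓ hℓ => ⟨hstep ℓ hℓ, horig ℓ hℓ, (hmenu ℓ hℓ).1, hbL ℓ hℓ, hidx ℓ hℓ⟩, haff, ?_, ?_, hst⟩
  · obtain ⟨p, hp1, hp2⟩ := hp
    refine ⟨p, fun j hj' => ?_, hp2⟩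
    obtain ⟨h1, h2, h3⟩ := hp1 j hj'
    exact ⟨h1, by rw [h2, hA0], h3⟩
  · obtain ⟨jj, hjj1, hjj2⟩ := hj
    exact ⟨jj, hjj1, by rw [hjj2, ht0]⟩

end ColumnWord

end Summit.Ventures.Crystal3D.Theorems

end
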